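import Literature.AlgebraicGeometry.Morphisms.CechUnitCocycleTwoFaceLift
import HarnessLib

/-!
# Step (I) of the theorem of the cube over a general base, cocycle form: the tower («by induction on the length»)
# (Görtz–Wedhorn II, Lemma 24.72 Step (I))

Layer `Literature/AlgebraicGeometry/Morphisms`, namespace `Literature.AlgebraicGeometry.Morphisms.CechUnitCocycle`.
THEOREMS ONLY (no definition, no named fact, no instance, no notation).  Cell `hodgecm-mathlib` (D-0151), F-2d road (R-def)
«theorem of the cube over a NON-reduced base by Artinian induction», Step (I) brick Č4c′ (author B-p07 (g16); sequel of ★ Č4c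
`CechUnitCocycleTwoFaceLift`, whose one-step lift `exists_rel_of_rel_map_of_rel_faces` it iterates).

**`forall_exists_rel_of_tower`**: along a tower of small extensions `π_n : R_{n+1} ↠ R_n` of `A`-algebras with common residue
algebra `k` (e.g. `R_n = 𝒪_{T,t}/𝔪^{n+1}`, `k = κ(t)`), a COMPATIBLE system of unit cocycles `u_n` over `R_n` on an affine cover
of the flat family `X/Spec A` that is trivial at level `0` and trivial on both faces at every level is trivial at EVERY level —
granted Künneth injectivity on the fibre cover and Stein on the faces at every level (hypotheses in Čech form, as in Č4c).
This is [GortzWedhorn2023] Lemma 24.72, proof, Step (I) («we show by induction on the length of `A` that `𝓔_{|X ⊗ A}` is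
trivial») in the currency of ★ `UCocycle`; the translation to line bundles and the globalisation (Step (II)) are downstream.

HC_CM is proved only modulo the 7 printed citations until rung 0 closes; nothing here is about HC.

## References
* [GortzWedhorn2023] U. Görtz, T. Wedhorn, *Algebraic Geometry II* (2023), Lemma 24.72 proof Step (I) (p. 409).
* [MumfordAV1970] D. Mumford, *Abelian Varieties* (1970), §6, the theorem of the cube (deformation step of the proof).
-/

noncomputable section

universe u v

open TensorProduct CategoryTheory AlgebraicGeometry
open Literature.RingTheory.Flat Literature.RingTheory.Flat.IsSmallExtension

namespace Literature.AlgebraicGeometry.Morphisms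

namespace CechUnitCocycle

variable {A : Type u} [CommRing A] {X : Scheme.{u}} {f : X ⟶ Spec (.of A)} {ι : Type v} {U : ι → X.Opens}

/-- `jY⁻¹U_i ∩ jY⁻¹U_j ⊆ jY⁻¹(U_i ∩ U_j)` (private plumbing). [folklore] -/
private theorem pre2 {Y : Scheme.{u}} (jY : Y ⟶ X) (U : ι → X.Opens) (i j : ι) :
    preimageFamily jY U i ⊓ preimageFamily jY U j ≤ jY ⁻¹ᵁ (U i ⊓ U j) :=
  fun _ hx => hx

/-! ## §5 THE TOWER -/

section Tower

variable {k : Type u} [CommRing k] [Algebra A k]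
  {Rn : ℕ → Type u} [∀ n, CommRing (Rn n)] [∀ n, Algebra A (Rn n)]
  {πn : ∀ n, Rn (n + 1) →ₐ[A] Rn n} {ρn : ∀ n, Rn n →ₐ[A] k} {In : ∀ n, Ideal (Rn (n + 1))} {dn : ℕ → ℕ}
  {en : ∀ n, (Fin (dn n) → k) ≃ₗ[A] In n}
  (Hn : ∀ n, IsSmallExtension (πn n) (ρn (n + 1)) (In n) (en n)) (hρn : ∀ n, (ρn n).comp (πn n) = ρn (n + 1))
  (hfl : ∀ V : X.Opens, IsAffineOpen V → Module.Flat A (Sections f V))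
  (hU : ∀ i, IsAffineOpen (U i)) (hU2 : ∀ i j, IsAffineOpen (U i ⊓ U j)) (hU3 : ∀ i j l, IsAffineOpen (U i ⊓ U j ⊓ U l))
  {Z : Scheme.{u}} {fZ : Z ⟶ Spec (.of k)} {g : Z ⟶ X}
  (HP : IsPullback g fZ f (Spec.map (CommRingCat.ofHom (algebraMap A k))))
  {Y₁ : Scheme.{u}} {fY₁ : Y₁ ⟶ Spec (.of A)} {jY₁ : Y₁ ⟶ X} (hj₁ : jY₁ ≫ f = fY₁)
  (hflY₁ : ∀ V : Y₁.Opens, IsAffineOpen V → Module.Flat A (Sections fY₁ V))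
  (hUY2₁ : ∀ i j, IsAffineOpen (preimageFamily jY₁ U i ⊓ preimageFamily jY₁ U j))
  (hUY3₁ : ∀ i j l, IsAffineOpen (preimageFamily jY₁ U i ⊓ preimageFamily jY₁ U j ⊓ preimageFamily jY₁ U l))
  {W₁ : Scheme.{u}} {fW₁ : W₁ ⟶ Spec (.of k)} {gW₁ : W₁ ⟶ Y₁} (hgW₁ : gW₁ ≫ fY₁ = restrictBase A fW₁)
  {hW₁ : W₁ ⟶ Z} (hhW₁ : hW₁ ≫ fZ = fW₁) (hsq₁ : hW₁ ≫ g = gW₁ ≫ jY₁)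
  {Y₂ : Scheme.{u}} {fY₂ : Y₂ ⟶ Spec (.of A)} {jY₂ : Y₂ ⟶ X} (hj₂ : jY₂ ≫ f = fY₂)
  (hflY₂ : ∀ V : Y₂.Opens, IsAffineOpen V → Module.Flat A (Sections fY₂ V))
  (hUY2₂ : ∀ i j, IsAffineOpen (preimageFamily jY₂ U i ⊓ preimageFamily jY₂ U j))
  (hUY3₂ : ∀ i j l, IsAffineOpen (preimageFamily jY₂ U i ⊓ preimageFamily jY₂ U j ⊓ preimageFamily jY₂ U l))
  {W₂ : Scheme.{u}} {fW₂ : W₂ ⟶ Spec (.of k)} {gW₂ : W₂ ⟶ Y₂} (hgW₂ : gW₂ ≫ fY₂ = restrictBase A fW₂)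
  {hW₂ : W₂ ⟶ Z} (hhW₂ : hW₂ ≫ fZ = fW₂) (hsq₂ : hW₂ ≫ g = gW₂ ≫ jY₂)
  (hK : ∀ c : CechH1 (restrictBase A fZ) (preimageFamily g U),
    cechComapH1 (restrictBase A fZ) (restrictBase A fW₁) hW₁ (by rw [restrictBase, ← Category.assoc, hhW₁])
      (preimageFamily g U) c = 0 →
    cechComapH1 (restrictBase A fZ) (restrictBase A fW₂) hW₂ (by rw [restrictBase, ← Category.assoc, hhW₂])
      (preimageFamily g U) c = 0 → c = 0)
  (hSt₁ : ∀ n (c : UCochain0 fY₁ (preimageFamily jY₁ U) (Rn n)),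
    (∀ i j, resR fY₁ (Rn n) (inf_le_left : preimageFamily jY₁ U i ⊓ preimageFamily jY₁ U j ≤ preimageFamily jY₁ U i)
        (c i : Sections fY₁ (preimageFamily jY₁ U i) ⊗[A] Rn n) =
      resR fY₁ (Rn n) (inf_le_right : preimageFamily jY₁ U i ⊓ preimageFamily jY₁ U j ≤ preimageFamily jY₁ U j)
        (c j : Sections fY₁ (preimageFamily jY₁ U j) ⊗[A] Rn n)) →
    ∃ r : Rn n, ∀ i, (c i : Sections fY₁ (preimageFamily jY₁ U i) ⊗[A] Rn n) = 1 ⊗ₜ r)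
  (hSt₂ : ∀ n (c : UCochain0 fY₂ (preimageFamily jY₂ U) (Rn n)),
    (∀ i j, resR fY₂ (Rn n) (inf_le_left : preimageFamily jY₂ U i ⊓ preimageFamily jY₂ U j ≤ preimageFamily jY₂ U i)
        (c i : Sections fY₂ (preimageFamily jY₂ U i) ⊗[A] Rn n) =
      resR fY₂ (Rn n) (inf_le_right : preimageFamily jY₂ U i ⊓ preimageFamily jY₂ U j ≤ preimageFamily jY₂ U j)
        (c j : Sections fY₂ (preimageFamily jY₂ U j) ⊗[A] Rn n)) →
    ∃ r : Rn n, ∀ i, (c i : Sections fY₂ (preimageFamily jY₂ U i) ⊗[A] Rn n) = 1 ⊗ₜ r)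

include Hn hρn hfl hU hU2 hU3 HP hj₁ hflY₁ hUY2₁ hUY3₁ hgW₁ hhW₁ hsq₁ hj₂ hflY₂ hUY2₂ hUY3₂ hgW₂ hhW₂ hsq₂ hK hSt₁ hSt₂ in
/-- **THE TOWER — Step (I) of [GortzWedhorn2023] Lemma 24.72 at every infinitesimal level, cocycle form** («by induction on
the length of `A`»): along a tower of small extensions `π_n : R_{n+1} ↠ R_n` of `A`-algebras with common residue algebra `k`
(`ρ_n`, framed kernels `e_n : k^{d_n} ≅ I_n`; e.g. `R_n = 𝒪_{T,t}/𝔪^{n+1}`), a COMPATIBLE system of unit cocycles `u_n` over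
`R_n` on the affine cover `𝒰` of the flat family `X/Spec A` (`u_n = u_{n+1} mod I_n`) that is trivial at level `0` (the fibre,
`h0`) and trivial on both faces at every level (`hg_m`) is trivial at every level — granted Künneth injectivity on the fibre
cover (`hK`) and Stein on the faces at every level (`hSt_m`).  Induction on `n` with §4.
[cite: GortzWedhorn2023, Lemma 24.72 proof Step (I) (p. 409)] [cite: MumfordAV1970, §6 (theorem of the cube, proof)] -/
theorem forall_exists_rel_of_tower
    (t : ∀ n, UCocycle f U (Rn n)) (ht : ∀ n i j, (t n).val i j = 1)
    (u : ∀ n, UCocycle f U (Rn n)) (hu : ∀ n i j, (u n).val i j = coef f (πn n) _ ((u (n + 1)).val i j))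
    (tY₁ : ∀ n, UCocycle fY₁ (preimageFamily jY₁ U) (Rn n)) (htY₁ : ∀ n i j, (tY₁ n).val i j = 1)
    (uY₁ : ∀ n, UCocycle fY₁ (preimageFamily jY₁ U) (Rn n))
    (huY₁ : ∀ n i j, (uY₁ n).val i j =
      Algebra.TensorProduct.map (Sections.comap f fY₁ jY₁ hj₁ (pre2 jY₁ U i j)) (AlgHom.id A (Rn n)) ((u n).val i j))
    (g₁ : ∀ n, UCochain0 fY₁ (preimageFamily jY₁ U) (Rn n))
    (hg₁ : ∀ n, Rel (tY₁ n) (uY₁ n) (fun i => (g₁ n i : Sections fY₁ (preimageFamily jY₁ U i) ⊗[A] Rn n)))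
    (tY₂ : ∀ n, UCocycle fY₂ (preimageFamily jY₂ U) (Rn n)) (htY₂ : ∀ n i j, (tY₂ n).val i j = 1)
    (uY₂ : ∀ n, UCocycle fY₂ (preimageFamily jY₂ U) (Rn n))
    (huY₂ : ∀ n i j, (uY₂ n).val i j =
      Algebra.TensorProduct.map (Sections.comap f fY₂ jY₂ hj₂ (pre2 jY₂ U i j)) (AlgHom.id A (Rn n)) ((u n).val i j))
    (g₂ : ∀ n, UCochain0 fY₂ (preimageFamily jY₂ U) (Rn n))
    (hg₂ : ∀ n, Rel (tY₂ n) (uY₂ n) (fun i => (g₂ n i : Sections fY₂ (preimageFamily jY₂ U i) ⊗[A] Rn n)))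
    (h0 : ∃ h : UCochain0 f U (Rn 0), Rel (t 0) (u 0) (fun i => (h i : Sections f (U i) ⊗[A] Rn 0))) :
    ∀ n, ∃ h : UCochain0 f U (Rn n), Rel (t n) (u n) (fun i => (h i : Sections f (U i) ⊗[A] Rn n)) := by
  intro n
  induction n with
  | zero => exact h0
  | succ n ih =>
    obtain ⟨hn, hrn⟩ := ih
    have hu₀ : Rel ((t (n + 1)).map (πn n)) ((u (n + 1)).map (πn n)) (fun i => (hn i : Sections f (U i) ⊗[A] Rn n)) :=
      Rel.congr (u := t n) (u' := u n) (fun i j => by rw [UCocycle.map_val, ht, ht, map_one])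
        (fun i j => by rw [UCocycle.map_val, hu]) hrn
    exact exists_rel_of_rel_map_of_rel_faces (Hn n) (hρn n) hfl hU hU2 hU3 HP hj₁ hflY₁ hUY2₁ hUY3₁ hgW₁ hhW₁ hsq₁
      hj₂ hflY₂ hUY2₂ hUY3₂ hgW₂ hhW₂ hsq₂ hK (hSt₁ n) (hSt₂ n) (t (n + 1)) (ht (n + 1)) (u (n + 1)) hn hu₀
      (tY₁ (n + 1)) (htY₁ (n + 1)) (uY₁ (n + 1)) (huY₁ (n + 1)) (g₁ (n + 1)) (hg₁ (n + 1))
      (tY₂ (n + 1)) (htY₂ (n + 1)) (uY₂ (n + 1)) (huY₂ (n + 1)) (g₂ (n + 1)) (hg₂ (n + 1))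

end Tower

end CechUnitCocycle

end Literature.AlgebraicGeometry.Morphisms

end
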